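import Mathlib.RingTheory.Localization.AtPrime.Basic
import Mathlib.RingTheory.Localization.Ideal
import Mathlib.RingTheory.MvPolynomial.Basic
import Mathlib.RingTheory.Polynomial.Basic
import Mathlib.RingTheory.FiniteType
import Mathlib.FieldTheory.IsAlgClosed.Basic
import Mathlib.RingTheory.Noetherian.Basic
import Mathlib.RingTheory.Ideal.Operations
import HarnessLib

/-!
# Symbolic powers `P^{(m)} = P^m A_P ∩ A`, the symbolic Rees algebra `R_S(P) = ⊕_m P^{(m)} T^m ⊆ A[T]`, and the NAMED FACT
# «over every field there is a prime of the polynomial ring in twelve variables whose symbolic Rees algebra is not Noetherian»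
# (Sannai–Tanaka 2019, Theorem 1.2 = Theorem 3.7 (2))

Topic: `Literature/RingTheory/GradedAlgebra` (Rees-type graded algebras; companions `VeroneseOfFiltration`,
`VeroneseOfFiltrationConverse`). Source: A. Sannai, H. Tanaka, «Infinitely generated symbolic Rees algebras over finite fields»,
Algebra & Number Theory 13 (2019) 1879–1891, doi:10.2140/ant.2019.13.1879, arXiv:1703.09121 — HELD (`paper:arxiv-1703.09121`),
read in seat on the arXiv text: Question 1.1 (p.1 l.11–14: «Set `P^{(m)} := P^m A_P ∩ A`. Then is the symbolic Rees algebra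
`R_S(P) := ⊕_{m=0}^{∞} P^{(m)}` a finitely generated `k`-algebra?»), **Theorem 1.2** (p.1 l.31–35: «Let `k` be a field. Let `A` be the
polynomial ring over `k` with twelve variables. Then there exists a prime ideal `𝔭` of `A` whose symbolic Rees algebra
`⊕_{m=0}^{∞} 𝔭^{(m)}` is not a noetherian ring.»), Theorem 3.7 (p.9 l.50–61: (1) `k` algebraically closed, `q ≥ 6` variables,
homogeneous prime; (2) any field, `q ≥ 12`).

**Contents.**
* `symbPow P m` — the `m`-th symbolic power `P^m A_P ∩ A` of a prime `P` (contraction of `P^m A_P` along `A → A_P`), with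
  `mem_symbPow_iff` (`x ∈ P^{(m)} ⟺ ∃ s ∉ P, s x ∈ P^m`), `symbPow_zero`, `pow_le_symbPow`, `symbPow_mul_le`;
* `symbolicReesAlgebra P ⊆ A[T]` — the polynomials whose `m`-th coefficient lies in `P^{(m)}` (an `A`-subalgebra), with
  `mem_symbolicReesAlgebra_iff`;
* `SannaiTanaka2019_Thm1_2` — the NAMED FACT, a `def … : Prop` AS PRINTED (no proof attempted: the proof goes through Totaro's nef
  non-semiample divisors over finite fields, Bertini over finite fields and Cox rings, far from the tree); `SannaiTanaka2019_Thm3_7_1` —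
  the algebraically-closed-field form (`q ≥ 6` variables; homogeneity clause dropped, TODO);
* `not_fg_of_not_isNoetherianRing` — over a Noetherian `A`, a NON-Noetherian subalgebra of `A[T]` is NOT finitely generated (Hilbert's
  basis theorem), the form in which the fact is consumed («`⊕ 𝔭^{(m)}` is not a finitely generated `A`-algebra»).
Why (consumer): cell `res-hironaka`, GAP-LEDGER R12/12a trigger (u) — the hypothesis `hfg` of
`Summit.….CampaignW36.not_exists_isCoreFocus_cone` (the cone datum over a perfect field of characteristic `p`). AI-typed statement of
a published theorem; weaker than expert review.
-/

noncomputable section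

open Polynomial

namespace Literature.RingTheory.GradedAlgebra

universe u

variable {A : Type u} [CommRing A]

/-! ## Symbolic powers of a prime -/

/-- **The `m`-th symbolic power `P^{(m)} := P^m A_P ∩ A`** of a prime ideal `P` (Sannai–Tanaka, Question 1.1 / Notation 2.2 (iii)):
the contraction of `P^m A_P` along the localisation map `A → A_P`. [cite: SannaiTanaka2019, Question 1.1 (p.1879)] -/
def symbPow (P : Ideal A) [P.IsPrime] (m : ℕ) : Ideal A :=
  ((P ^ m).map (algebraMap A (Localization.AtPrime P))).comap (algebraMap A (Localization.AtPrime P))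

/-- `x ∈ P^{(m)} ⟺ s x ∈ P^m` for some `s ∉ P`. [cite: SannaiTanaka2019, Question 1.1 (p.1879)] -/
theorem mem_symbPow_iff (P : Ideal A) [hP : P.IsPrime] (m : ℕ) (x : A) :
    x ∈ symbPow P m ↔ ∃ s ∉ P, s * x ∈ P ^ m := by
  rw [symbPow, Ideal.mem_comap, IsLocalization.mem_map_algebraMap_iff P.primeCompl]
  constructor
  · rintro ⟨⟨⟨a, ha⟩, ⟨s, hs⟩⟩, h⟩
    simp only at h
    have h0 : algebraMap A (Localization.AtPrime P) (x * s - a) = 0 := by rw [map_sub, map_mul, h, sub_self]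
    obtain ⟨⟨t, ht⟩, htt⟩ := (IsLocalization.map_eq_zero_iff P.primeCompl (Localization.AtPrime P) _).mp h0
    simp only at htt
    rw [mul_sub, sub_eq_zero] at htt
    refine ⟨t * s, fun h' => (hP.mem_or_mem h').elim ht hs, ?_⟩
    rw [show t * s * x = t * (x * s) by ring, htt]
    exact (P ^ m).mul_mem_left t ha
  · rintro ⟨s, hs, hsx⟩
    refine ⟨⟨⟨s * x, hsx⟩, ⟨s, hs⟩⟩, ?_⟩
    simp only [map_mul]
    ring

/-- `P^{(0)} = A`. [cite: SannaiTanaka2019, Question 1.1 (p.1879)] -/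
theorem symbPow_zero (P : Ideal A) [hP : P.IsPrime] : symbPow P 0 = ⊤ :=
  top_le_iff.mp fun x _ => (mem_symbPow_iff P 0 x).mpr ⟨1, (Ideal.ne_top_iff_one P).mp hP.ne_top, by simp⟩

/-- `P^m ⊆ P^{(m)}`. [cite: SannaiTanaka2019, Question 1.1 (p.1879)] -/
theorem pow_le_symbPow (P : Ideal A) [hP : P.IsPrime] (m : ℕ) : P ^ m ≤ symbPow P m := fun x hx =>
  (mem_symbPow_iff P m x).mpr ⟨1, (Ideal.ne_top_iff_one P).mp hP.ne_top, by simpa using hx⟩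

/-- `P^{(a)} P^{(c)} ⊆ P^{(a+c)}`. [cite: SannaiTanaka2019, Question 1.1 (p.1879)] -/
theorem symbPow_mul_le (P : Ideal A) [hP : P.IsPrime] (a c : ℕ) : symbPow P a * symbPow P c ≤ symbPow P (a + c) := by
  refine Ideal.mul_le.mpr fun f hf g hg => ?_
  obtain ⟨s, hs, hsf⟩ := (mem_symbPow_iff P a f).mp hf
  obtain ⟨t, ht, htg⟩ := (mem_symbPow_iff P c g).mp hg
  refine (mem_symbPow_iff P (a + c) _).mpr ⟨s * t, fun h => (hP.mem_or_mem h).elim hs ht, ?_⟩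
  rw [show s * t * (f * g) = (s * f) * (t * g) by ring, pow_add]
  exact Ideal.mul_mem_mul hsf htg

/-! ## The symbolic Rees algebra -/

/-- **The symbolic Rees algebra `R_S(P) = ⊕_{m ≥ 0} P^{(m)} T^m ⊆ A[T]`** of a prime `P` (Sannai–Tanaka, Question 1.1): the
`A`-subalgebra of `A[T]` of the polynomials whose `m`-th coefficient lies in `P^{(m)}` for every `m`.
[cite: SannaiTanaka2019, Question 1.1 (p.1879)] -/
def symbolicReesAlgebra (P : Ideal A) [P.IsPrime] : Subalgebra A A[X] where
  carrier := {f | ∀ m, f.coeff m ∈ symbPow P m}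
  mul_mem' := by
    intro f g hf hg m
    rw [coeff_mul]
    refine Submodule.sum_mem _ fun ij hij => ?_
    obtain ⟨i, j⟩ := ij
    have hm : i + j = m := by simpa using hij
    rw [← hm]
    exact symbPow_mul_le P i j (Ideal.mul_mem_mul (hf i) (hg j))
  add_mem' := by
    intro f g hf hg m
    rw [coeff_add]
    exact add_mem (hf m) (hg m)
  algebraMap_mem' := by
    intro r m
    rw [Polynomial.algebraMap_eq, coeff_C]
    split_ifs with h
    · subst h; rw [symbPow_zero]; exact Submodule.mem_top
    · exact zero_mem _

/-- Membership in `R_S(P)`, coefficientwise. [cite: SannaiTanaka2019, Question 1.1 (p.1879)] -/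
theorem mem_symbolicReesAlgebra_iff (P : Ideal A) [P.IsPrime] (f : A[X]) :
    f ∈ symbolicReesAlgebra P ↔ ∀ m, f.coeff m ∈ symbPow P m :=
  Iff.rfl

/-! ## The named fact -/

/-- **NAMED FACT (Sannai–Tanaka 2019, Theorem 1.2 = Theorem 3.7 (2)).** «Let `k` be a field. Let `A` be the polynomial ring over `k`
with twelve variables. Then there exists a prime ideal `𝔭` of `A` whose symbolic Rees algebra `⊕_{m=0}^{∞} 𝔭^{(m)}` is not a noetherian
ring.» Typed AS PRINTED as a `Prop`; NOT proved here (the proof uses a Totaro surface with a nef non-semiample divisor, Bertini theorems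
over finite fields and the Cox ring of the blow-up, Thm 3.6 / Prop 2.14 of the source).
-- TODO(general form): Thm 3.7 (1): for `k` algebraically closed, `q ≥ 6` variables suffice and `𝔭` may be taken homogeneous.
[cite: SannaiTanaka2019, Thm 1.2 (p.1879); Thm 3.7 (p.1889)] -/
def SannaiTanaka2019_Thm1_2 : Prop :=
  ∀ (k : Type u) [Field k], ∃ (P : Ideal (MvPolynomial (Fin 12) k)) (_ : P.IsPrime), ¬ IsNoetherianRing (symbolicReesAlgebra P)

/-- **NAMED FACT (Sannai–Tanaka 2019, Theorem 3.7 (1)).** «Let `q` be an integer such that `q ≥ 6`. If `k` is an algebraically closed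
field, then there exists a homogeneous prime ideal `𝔭` of the polynomial ring `k[x_1, ⋯, x_q]` with `q` variables whose symbolic Rees
algebra `⊕_{m=0}^{∞} 𝔭^{(m)}` is not a noetherian ring.» Typed as a `Prop` WITHOUT the homogeneity clause (a weakening of the printed
statement; the tree's use does not need it); NOT proved here.
-- TODO(general form): `𝔭` homogeneous for the standard grading of `k[x_1, ⋯, x_q]`.
[cite: SannaiTanaka2019, Thm 3.7 (1) (p.1889)] -/
def SannaiTanaka2019_Thm3_7_1 : Prop :=
  ∀ (k : Type u) [Field k] [IsAlgClosed k] (q : ℕ), 6 ≤ q →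
    ∃ (P : Ideal (MvPolynomial (Fin q) k)) (_ : P.IsPrime), ¬ IsNoetherianRing (symbolicReesAlgebra P)

/-! ## How the facts are consumed: non-Noetherian ⇒ not finitely generated -/

/-- Over a Noetherian ring `A`, a finitely generated `A`-subalgebra of `A[T]` is a Noetherian ring (Hilbert's basis theorem); hence a
NON-Noetherian subalgebra — e.g. Sannai–Tanaka's `⊕ 𝔭^{(m)}` — is NOT finitely generated over `A`.
[cite: SannaiTanaka2019, Question 1.1 and Thm 1.2 (p.1879)] -/
theorem not_fg_of_not_isNoetherianRing [IsNoetherianRing A] (S : Subalgebra A A[X]) (h : ¬ IsNoetherianRing S) : ¬ S.FG := by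
  intro hFG
  haveI : Algebra.FiniteType A S := (Subalgebra.fg_iff_finiteType S).mp hFG
  exact h (Algebra.FiniteType.isNoetherianRing A S)

/-- The consumed form: for every field `k` there is a prime `𝔭 ⊂ k[x₁,…,x₁₂]` whose symbolic Rees algebra is NOT a finitely
generated `k[x₁,…,x₁₂]`-algebra. [cite: SannaiTanaka2019, Thm 1.2 (p.1879)] -/
theorem exists_not_fg_symbolicReesAlgebra_of_SannaiTanaka (h : SannaiTanaka2019_Thm1_2.{u}) (k : Type u) [Field k] :
    ∃ (P : Ideal (MvPolynomial (Fin 12) k)) (_ : P.IsPrime), ¬ (symbolicReesAlgebra P).FG := by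
  obtain ⟨P, hP, hN⟩ := h k
  exact ⟨P, hP, not_fg_of_not_isNoetherianRing _ hN⟩

/-- The consumed form of Thm 3.7 (1): over an algebraically closed field, `q ≥ 6` variables suffice.
[cite: SannaiTanaka2019, Thm 3.7 (1) (p.1889)] -/
theorem exists_not_fg_symbolicReesAlgebra_of_SannaiTanaka' (h : SannaiTanaka2019_Thm3_7_1.{u}) (k : Type u) [Field k]
    [IsAlgClosed k] {q : ℕ} (hq : 6 ≤ q) :
    ∃ (P : Ideal (MvPolynomial (Fin q) k)) (_ : P.IsPrime), ¬ (symbolicReesAlgebra P).FG := by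
  obtain ⟨P, hP, hN⟩ := h k q hq
  exact ⟨P, hP, not_fg_of_not_isNoetherianRing _ hN⟩

end Literature.RingTheory.GradedAlgebra

end
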